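import Literature.NumberTheory.Transcendental.MultipleZetaProofs
import HarnessLib

/-!
# Multiple zeta values — proofs: Euler's identity `ζ(2,1) = ζ(3)`

Sibling proof file of `Literature.NumberTheory.Transcendental.MultipleZeta` (D-0014 keeps
`Literature/` sorry-free by stating cited results as named facts `def X : Prop`). It discharges
the named fact `Literature.NumberTheory.Transcendental.euler_zeta_two_one` — Euler's identity
`ζ(2,1) = ζ(3)`, i.e. `multipleZeta [2, 1] = multipleZeta [3]` — as `euler_zeta_two_one_holds`.
Users holding `(h : euler_zeta_two_one)` (e.g. `mzvSpace_three_eq` and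
`finrank_mzvSpace_eq_zagierDim_of_le_three` in `MultipleZetaValuesProofs.lean`, Zagier's dimension
conjecture in weights `≤ 3`) are fed `euler_zeta_two_one_holds`.

## The source and this file

Borwein–Bradley (*Thirty-two Goldbach variations*, Int. J. Number Theory 2 (2006), §1.2) use the
same decreasing convention `ζ(s₁, …, s_m) = ∑_{k₁ > ⋯ > k_m > 0} ∏ k_j^{-s_j}` as
`Literature.NumberTheory.Transcendental.multipleZeta` (Zagier, ECM 1994, p. 497 eq. (2), prints
the increasing order, under which the same number is written `ζ(1,2)`), and record that the
identity `ζ(2,1) = ζ(3)` "goes back to Euler". Their §2 ("Telescoping and Partial Fractions", an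
argument they trace back at least to Steinberg) proves it through the auxiliary sum
`S = ∑_{n,k>0} 1/(nk(n+k))`: telescoping `1/(k(n+k))` in `k` gives
`S = ∑_n n^{-2} ∑_{k ≤ n} 1/k = ζ(3) + ζ(2,1)`, while the partial fraction
`1/(nk) = (1/n + 1/k)/(n+k)` gives `S = 2 ζ(2,1)` by symmetry.

This file formalises exactly this argument. Write (all indices from `0`)
`Z₂₁ = ∑_{m,n ≥ 0} 1/((m+1)(m+n+2)²)` — this is `ζ(2,1)` in the product coordinates
`n₁ = m+n+2 > n₂ = m+1 ≥ 1` on the summation domain `mzvIndexSet 2`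
(`tsum_mzvIndexSet_two`, `multipleZeta_two_one_eq_tsum`) —, `Z₃ = ∑_{n ≥ 0} (n+1)^{-3}`
(`= ζ(3)` by `multipleZeta_singleton_holds`) and `S = ∑_{m,n ≥ 0} 1/((m+1)(n+1)(m+n+2))`, all
three in `ℝ≥0∞`, where every term is nonnegative and rearrangements (`ENNReal.tsum_prod'`,
`ENNReal.tsum_comm`, `Equiv.tsum_eq`) need no summability bookkeeping. The partial fraction gives
`S = Z₂₁ + Z₂₁` (`tsum_eulerAux_eq_add_self`); the telescoping decomposition
`1/((m+1)(m+n+2)) = (n+1)⁻¹ ∑_{k ≤ n} 1/((m+k+1)(m+k+2))` with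
`∑_{m ≥ 0} 1/((m+k+1)(m+k+2)) = 1/(k+1)` gives
`∑_m 1/((m+1)(n+1)(m+n+2)) = (n+1)^{-3} + ∑_{k<n} 1/((k+1)(n+1)²)` (`tsum_eulerAux_inner`), whence
`S = Z₃ + Z₂₁` (`tsum_eulerAux_eq_add`, reindexing the triangle `k < n`). The one finiteness
input is `Z₂₁ ≤ ∑_m (m+1)^{-2} < ∞` (`tsum_zetaTwoOne_ne_top`, by the same telescoping), after
which cancellation in `ℝ≥0∞` gives `Z₂₁ = Z₃` (`tsum_zetaTwoOne_eq_tsum_zetaThree`) and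
`ENNReal.tsum_toReal_eq` returns to `ℝ`.

## References

* J. M. Borwein, D. M. Bradley, *Thirty-two Goldbach variations*, Int. J. Number Theory 2
  (2006), 65–103 (arXiv:math/0502034, "On two fundamental identities for Euler sums") — §1.2
  (the identity `ζ(2,1) = ζ(3)`, due to Euler; the decreasing summation convention), §2 (the
  telescoping / partial-fraction proof). [BorweinBradley2006]
* D. Zagier, *Values of zeta functions and their applications*, First European Congress of
  Mathematics (Paris, 1992), Vol. II, Progr. Math. 120, Birkhäuser (1994), 497–512 — p. 497
  eq. (2) (definition), §9. [ZagierECM1994]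
-/

noncomputable section

open scoped BigOperators ENNReal
open Filter _root_.Topology

namespace Literature.NumberTheory.Transcendental

/-! ### Telescoping, and the two evaluations of `S` in `ℝ≥0∞` -/

/-- Telescoping partial sums: `∑_{m<M} 1/((m+k+1)(m+k+2)) = 1/(k+1) - 1/(M+k+1)`. [folklore] -/
private theorem sum_range_inv_mul_succ (k M : ℕ) :
    ∑ m ∈ Finset.range M, (1 : ℝ) / (((m : ℝ) + k + 1) * ((m : ℝ) + k + 2)) =
      1 / ((k : ℝ) + 1) - 1 / ((M : ℝ) + k + 1) := by
  induction M with
  | zero => simp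
  | succ M ih =>
    rw [Finset.sum_range_succ, ih]
    push_cast
    field_simp
    ring

/-- Telescoping partial sums in the shift variable:
`∑_{k<N} 1/((m+k+1)(m+k+2)) = 1/(m+1) - 1/(m+N+1)`. [folklore] -/
private theorem sum_range_inv_mul_succ' (m N : ℕ) :
    ∑ k ∈ Finset.range N, (1 : ℝ) / (((m : ℝ) + k + 1) * ((m : ℝ) + k + 2)) =
      1 / ((m : ℝ) + 1) - 1 / ((m : ℝ) + N + 1) := by
  induction N with
  | zero => simp
  | succ N ih =>
    rw [Finset.sum_range_succ, ih]
    push_cast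
    field_simp
    ring

/-- The telescoping series `∑_{m ≥ 0} 1/((m+k+1)(m+k+2)) = 1/(k+1)`. [folklore] -/
private theorem hasSum_inv_mul_succ (k : ℕ) :
    HasSum (fun m : ℕ => (1 : ℝ) / (((m : ℝ) + k + 1) * ((m : ℝ) + k + 2)))
      (1 / ((k : ℝ) + 1)) := by
  rw [hasSum_iff_tendsto_nat_of_nonneg (fun m => by positivity)]
  simp_rw [sum_range_inv_mul_succ]
  have h : Tendsto (fun M : ℕ => (1 : ℝ) / ((M : ℝ) + k + 1)) atTop (𝓝 0) := by
    refine ((tendsto_one_div_add_atTop_nhds_zero_nat (𝕜 := ℝ)).comp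
      (tendsto_add_atTop_nat k)).congr fun M => ?_
    simp only [Function.comp_apply, Nat.cast_add]
  simpa using h.const_sub ((1 : ℝ) / ((k : ℝ) + 1))

/-- The telescoping series in `ℝ≥0∞`: `∑_{m ≥ 0} 1/((m+k+1)(m+k+2)) = 1/(k+1)`. [folklore] -/
private theorem tsum_ofReal_inv_mul_succ (k : ℕ) :
    ∑' m : ℕ, ENNReal.ofReal ((1 : ℝ) / (((m : ℝ) + k + 1) * ((m : ℝ) + k + 2))) =
      ENNReal.ofReal (1 / ((k : ℝ) + 1)) := by
  rw [← ENNReal.ofReal_tsum_of_nonneg (fun m => by positivity) (hasSum_inv_mul_succ k).summable,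
    (hasSum_inv_mul_succ k).tsum_eq]

/-- The partial fraction `1/(ab(a+b)) = 1/(a(a+b)²) + 1/(b(b+a)²)` behind `S = 2 ζ(2,1)`,
with `a = m+1`, `b = n+1`. [folklore] -/
private theorem inv_mul_mul_add_eq (m n : ℕ) :
    (1 : ℝ) / (((m : ℝ) + 1) * ((n : ℝ) + 1) * ((m : ℝ) + n + 2)) =
      1 / (((m : ℝ) + 1) * ((m : ℝ) + n + 2) ^ 2) +
        1 / (((n : ℝ) + 1) * ((n : ℝ) + m + 2) ^ 2) := by
  field_simp
  ring

/-- `S = ζ(2,1) + ζ(2,1)` in `ℝ≥0∞`: split every term by the partial fraction and swap the two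
summation variables in the second half. [folklore] -/
private theorem tsum_eulerAux_eq_add_self :
    ∑' p : ℕ × ℕ, ENNReal.ofReal (1 / (((p.1 : ℝ) + 1) * ((p.2 : ℝ) + 1) * ((p.1 : ℝ) + p.2 + 2))) =
      (∑' p : ℕ × ℕ, ENNReal.ofReal (1 / (((p.1 : ℝ) + 1) * ((p.1 : ℝ) + p.2 + 2) ^ 2))) +
        ∑' p : ℕ × ℕ, ENNReal.ofReal (1 / (((p.1 : ℝ) + 1) * ((p.1 : ℝ) + p.2 + 2) ^ 2)) := by
  have h : ∀ p : ℕ × ℕ,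
      ENNReal.ofReal (1 / (((p.1 : ℝ) + 1) * ((p.2 : ℝ) + 1) * ((p.1 : ℝ) + p.2 + 2))) =
        ENNReal.ofReal (1 / (((p.1 : ℝ) + 1) * ((p.1 : ℝ) + p.2 + 2) ^ 2)) +
          ENNReal.ofReal (1 / (((p.2 : ℝ) + 1) * ((p.2 : ℝ) + p.1 + 2) ^ 2)) := fun p => by
    rw [inv_mul_mul_add_eq, ENNReal.ofReal_add (by positivity) (by positivity)]
  simp_rw [h]
  rw [ENNReal.tsum_add]
  congr 1
  exact (Equiv.prodComm ℕ ℕ).tsum_eq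
    (fun p : ℕ × ℕ => ENNReal.ofReal (1 / (((p.1 : ℝ) + 1) * ((p.1 : ℝ) + p.2 + 2) ^ 2)))

/-- Reindexing `∑_n ∑_{j<n} T j n = ∑_{(j,i)} T j (i+(j+1))` in `ℝ≥0∞`. [folklore] -/
private theorem tsum_sum_range_eq_tsum_prod (T : ℕ → ℕ → ℝ≥0∞) :
    ∑' n, ∑ j ∈ Finset.range n, T j n = ∑' p : ℕ × ℕ, T p.1 (p.2 + (p.1 + 1)) := by
  classical
  have h1 : ∀ n, ∑ j ∈ Finset.range n, T j n = ∑' j, if j < n then T j n else 0 := by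
    intro n
    rw [tsum_eq_sum (s := Finset.range n)
      (fun j hj => if_neg (fun h => hj (Finset.mem_range.mpr h)))]
    exact Finset.sum_congr rfl fun j hj => (if_pos (Finset.mem_range.mp hj)).symm
  have h2 : ∀ j, (∑' n, if j < n then T j n else 0) = ∑' i, T j (i + (j + 1)) := by
    intro j
    rw [← (ENNReal.summable).sum_add_tsum_nat_add' (f := fun n => if j < n then T j n else 0)
      (k := j + 1), Finset.sum_eq_zero (fun i hi => if_neg (by
        have := Finset.mem_range.mp hi; omega)), zero_add]
    exact tsum_congr fun i => if_pos (by omega)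
  simp_rw [h1]
  rw [ENNReal.tsum_comm]
  simp_rw [h2]
  rw [ENNReal.tsum_prod']

/-- The inner sum of `S` for fixed `n`: `∑_m 1/((m+1)(n+1)(m+n+2)) = H_{n+1}/(n+1)²`, written as
`(n+1)^{-3} + ∑_{k<n} 1/((k+1)(n+1)²)` (telescoping in `m`). [folklore] -/
private theorem tsum_eulerAux_inner (n : ℕ) :
    ∑' m : ℕ, ENNReal.ofReal (1 / (((m : ℝ) + 1) * ((n : ℝ) + 1) * ((m : ℝ) + n + 2))) =
      ENNReal.ofReal (1 / ((n : ℝ) + 1) ^ 3) +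
        ∑ k ∈ Finset.range n, ENNReal.ofReal (1 / (((k : ℝ) + 1) * ((n : ℝ) + 1) ^ 2)) := by
  have hdec : ∀ m : ℕ, ENNReal.ofReal (1 / (((m : ℝ) + 1) * ((n : ℝ) + 1) * ((m : ℝ) + n + 2))) =
      ∑ k ∈ Finset.range (n + 1), ENNReal.ofReal (1 / ((n : ℝ) + 1) ^ 2) *
        ENNReal.ofReal (1 / (((m : ℝ) + k + 1) * ((m : ℝ) + k + 2))) := by
    intro m
    simp_rw [← ENNReal.ofReal_mul (show (0 : ℝ) ≤ 1 / ((n : ℝ) + 1) ^ 2 by positivity)]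
    rw [← ENNReal.ofReal_sum_of_nonneg (fun k _ => by positivity), ← Finset.mul_sum,
      sum_range_inv_mul_succ']
    congr 1
    push_cast
    field_simp
    ring
  simp_rw [hdec]
  rw [Summable.tsum_finsetSum (fun _ _ => ENNReal.summable)]
  simp_rw [ENNReal.tsum_mul_left, tsum_ofReal_inv_mul_succ]
  rw [Finset.sum_range_succ, add_comm]
  congr 1
  · rw [← ENNReal.ofReal_mul (by positivity)]
    congr 1
    field_simp
  · refine Finset.sum_congr rfl fun k _ => ?_
    rw [← ENNReal.ofReal_mul (by positivity)]
    congr 1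
    field_simp

/-- `S = ζ(3) + ζ(2,1)` in `ℝ≥0∞`: sum the inner identity over `n` and reindex the triangle
`k < n` by `n = i + k + 1`. [folklore] -/
private theorem tsum_eulerAux_eq_add :
    ∑' p : ℕ × ℕ, ENNReal.ofReal (1 / (((p.1 : ℝ) + 1) * ((p.2 : ℝ) + 1) * ((p.1 : ℝ) + p.2 + 2))) =
      (∑' n : ℕ, ENNReal.ofReal (1 / ((n : ℝ) + 1) ^ 3)) +
        ∑' p : ℕ × ℕ, ENNReal.ofReal (1 / (((p.1 : ℝ) + 1) * ((p.1 : ℝ) + p.2 + 2) ^ 2)) := by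
  rw [ENNReal.tsum_prod', ENNReal.tsum_comm]
  simp_rw [tsum_eulerAux_inner]
  rw [ENNReal.tsum_add, tsum_sum_range_eq_tsum_prod]
  congr 1
  refine tsum_congr fun p => ?_
  congr 1
  push_cast
  ring

/-- `ζ(2,1) < ∞` in `ℝ≥0∞`: `1/((m+1)(m+n+2)²) ≤ (1/(m+1)) · 1/((n+m+1)(n+m+2))`, telescope in
`n`, and `∑ (m+1)^{-2} < ∞`. [folklore] -/
private theorem tsum_zetaTwoOne_ne_top :
    ∑' p : ℕ × ℕ, ENNReal.ofReal (1 / (((p.1 : ℝ) + 1) * ((p.1 : ℝ) + p.2 + 2) ^ 2)) ≠ ∞ := by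
  rw [ENNReal.tsum_prod']
  have hle : ∀ m : ℕ,
      ∑' n : ℕ, ENNReal.ofReal (1 / (((m : ℝ) + 1) * ((m : ℝ) + n + 2) ^ 2)) ≤
        ENNReal.ofReal (1 / ((m : ℝ) + 1) ^ 2) := by
    intro m
    calc ∑' n : ℕ, ENNReal.ofReal (1 / (((m : ℝ) + 1) * ((m : ℝ) + n + 2) ^ 2))
        ≤ ∑' n : ℕ, ENNReal.ofReal (1 / ((m : ℝ) + 1)) *
            ENNReal.ofReal (1 / (((n : ℝ) + m + 1) * ((n : ℝ) + m + 2))) := by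
          refine ENNReal.tsum_le_tsum fun n => ?_
          rw [← ENNReal.ofReal_mul (by positivity)]
          refine ENNReal.ofReal_le_ofReal ?_
          rw [div_mul_div_comm, one_mul]
          apply one_div_le_one_div_of_le (by positivity)
          have hm : (0 : ℝ) ≤ m := Nat.cast_nonneg m
          have hn : (0 : ℝ) ≤ n := Nat.cast_nonneg n
          nlinarith
      _ = ENNReal.ofReal (1 / ((m : ℝ) + 1)) * ENNReal.ofReal (1 / ((m : ℝ) + 1)) := by
          rw [ENNReal.tsum_mul_left, tsum_ofReal_inv_mul_succ]
      _ = ENNReal.ofReal (1 / ((m : ℝ) + 1) ^ 2) := by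
          rw [← ENNReal.ofReal_mul (by positivity), div_mul_div_comm, one_mul, ← pow_two]
  refine ne_top_of_le_ne_top ?_ (ENNReal.tsum_le_tsum hle)
  have hs : Summable fun m : ℕ => 1 / ((m : ℝ) + 1) ^ 2 := by
    exact_mod_cast (summable_nat_add_iff 1).mpr (Real.summable_one_div_nat_pow.mpr one_lt_two)
  rw [← ENNReal.ofReal_tsum_of_nonneg (fun m => by positivity) hs]
  exact ENNReal.ofReal_ne_top

/-- Euler's identity in `ℝ≥0∞`, product coordinates: `Z₂₁ = Z₃`, by cancelling `Z₂₁ < ∞` from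
`Z₂₁ + Z₂₁ = S = Z₃ + Z₂₁`. [folklore] -/
private theorem tsum_zetaTwoOne_eq_tsum_zetaThree :
    ∑' p : ℕ × ℕ, ENNReal.ofReal (1 / (((p.1 : ℝ) + 1) * ((p.1 : ℝ) + p.2 + 2) ^ 2)) =
      ∑' n : ℕ, ENNReal.ofReal (1 / ((n : ℝ) + 1) ^ 3) :=
  (ENNReal.add_left_inj tsum_zetaTwoOne_ne_top).mp
    (tsum_eulerAux_eq_add_self.symm.trans tsum_eulerAux_eq_add)

/-- Product coordinates on the summation domain of a depth-two multiple zeta value: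
`(m, n) ↦ (n₁, n₂) = (m+n+2, m+1)` is a bijection `ℕ × ℕ ≃ {n₁ > n₂ ≥ 1}`, so
`∑_{n₁ > n₂ ≥ 1} F(n₁, n₂) = ∑_{m,n ≥ 0} F(m+n+2, m+1)`. [folklore] -/
theorem tsum_mzvIndexSet_two (F : (Fin 2 → ℕ) → ℝ) :
    ∑' n : mzvIndexSet 2, F n.1 = ∑' p : ℕ × ℕ, F ![p.1 + p.2 + 2, p.1 + 1] := by
  let e : ℕ × ℕ ≃ mzvIndexSet 2 :=
    { toFun := fun p => ⟨![p.1 + p.2 + 2, p.1 + 1],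
        Fin.strictAnti_iff_succ_lt.mpr fun i => by
          fin_cases i
          simp,
        fun i => by fin_cases i <;> simp⟩
      invFun := fun n => (n.1 1 - 1, n.1 0 - n.1 1 - 1)
      left_inv := fun p => by
        ext
        · simp
        · simp
          omega
      right_inv := fun n => by
        obtain ⟨v, hv, hpos⟩ := n
        have h10 : v 1 < v 0 := hv (show (0 : Fin 2) < 1 by decide)
        have h1 : 0 < v 1 := hpos 1
        refine Subtype.ext (funext fun i => ?_)
        fin_cases i
        · simp
          omega
        · simp
          omega }
  exact (e.tsum_eq fun n => F n.1).symm

/-- The general term of `ζ(2,1)`: `mzvTerm [2,1] n = (n₀²)⁻¹ (n₁)⁻¹`. [folklore] -/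
theorem mzvTerm_two_one (n : Fin [2, 1].length → ℕ) :
    mzvTerm [2, 1] n = ((n 0 : ℝ) ^ 2)⁻¹ * ((n 1 : ℝ))⁻¹ := by
  unfold mzvTerm
  simp [mul_comm]

/-- `ζ(2,1)` as a double series over `ℕ × ℕ`:
`ζ(2,1) = ∑_{m,n ≥ 0} 1/((m+1)(m+n+2)²)` (`n₁ = m+n+2 > n₂ = m+1 ≥ 1` in
`ζ(2,1) = ∑_{n₁ > n₂ ≥ 1} n₁^{-2} n₂^{-1}`). [folklore] -/
theorem multipleZeta_two_one_eq_tsum :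
    multipleZeta [2, 1] = ∑' p : ℕ × ℕ, 1 / (((p.1 : ℝ) + 1) * ((p.1 : ℝ) + p.2 + 2) ^ 2) := by
  unfold multipleZeta
  refine (tsum_mzvIndexSet_two (mzvTerm [2, 1])).trans (tsum_congr fun p => ?_)
  rw [mzvTerm_two_one]
  simp only [Matrix.cons_val_zero, Matrix.cons_val_one]
  push_cast
  rw [one_div, mul_inv]
  exact mul_comm _ _

/-- **Euler's identity** `ζ(2,1) = ζ(3)` — discharge of the named fact `euler_zeta_two_one`
(`multipleZeta [2, 1] = multipleZeta [3]`). Borwein–Bradley, §1.2: in the convention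
`ζ(s₁,…,s_m) = ∑_{k₁>⋯>k_m>0} ∏ k_j^{-s_j}` (the convention of `multipleZeta`), "the identity
`ζ(2,1) = ζ(3)` goes back to Euler"; the proof is that of their §2 (telescoping and partial
fractions: `2 ζ(2,1) = S = ζ(3) + ζ(2,1)`), carried out in `ℝ≥0∞`
(`tsum_zetaTwoOne_eq_tsum_zetaThree`) and transferred to `multipleZeta` by
`multipleZeta_two_one_eq_tsum` and `multipleZeta_singleton_holds`.
[cite: BorweinBradley2006, §1.2 (identity ζ(2,1)=ζ(3)) and §2 (proof)] -/
theorem euler_zeta_two_one_holds : euler_zeta_two_one := by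
  show multipleZeta [2, 1] = multipleZeta [3]
  rw [multipleZeta_two_one_eq_tsum, multipleZeta_singleton_holds (k := 3) (by norm_num),
    ← tsum_congr fun p : ℕ × ℕ => ENNReal.toReal_ofReal
      (show (0 : ℝ) ≤ 1 / (((p.1 : ℝ) + 1) * ((p.1 : ℝ) + p.2 + 2) ^ 2) by positivity),
    ← tsum_congr fun n : ℕ => ENNReal.toReal_ofReal
      (show (0 : ℝ) ≤ 1 / ((n : ℝ) + 1) ^ 3 by positivity),
    ← ENNReal.tsum_toReal_eq (fun _ => ENNReal.ofReal_ne_top),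
    ← ENNReal.tsum_toReal_eq (fun _ => ENNReal.ofReal_ne_top), tsum_zetaTwoOne_eq_tsum_zetaThree]

end Literature.NumberTheory.Transcendental
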